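import Mathlib

/-!
# Star bounds for the tiny-leaf regime of the last seed (mine-3, gen 65; C-041.md §21 (az))

For a star with leaves `a : Fin (m + 2) → ℝ`, `0 ≤ a i ≤ 1`, and invariants `A = ∏ a i`, `B = ∏ (1 - a i)`,
`P₁ = ∏ (1 + a i ^ 2)`, `P₂ = ∏ (1 + (1 - a i) ^ 2)`:

* `(1 + A) ^ 2 ≤ P₁` and `(1 + B) ^ 2 ≤ P₂` (two factors by Cauchy–Schwarz, more by induction) — the floors that
  replace `1 + B ^ 2 ≤ P₂` on the tiny-leaf regions `B ≥ 1/2` and `A ≤ 1/20 ∧ P₁ ≤ 6/5`;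
* `B * 2 ^ n ≤ P₂` (leafwise `2 (1 - a) ≤ 1 + (1 - a) ^ 2`), the Weierstrass bound `1 - B ≤ Σ a i`, the sum of
  squares `Σ a i ^ 2 ≤ P₁ - 1` and Cauchy–Schwarz `(Σ a i) ^ 2 ≤ n Σ a i ^ 2`;
* combined: `B (1 - B) ^ (2 k) ≤ c (P₁ - 1) ^ k P₂` whenever `n ^ k ≤ c 2 ^ n` — with the polynomial proxies
  `n ^ 2 ≤ 2 · 2 ^ n`, `n ^ 3 ≤ 6 · 2 ^ n`, `n ^ 4 ≤ 24 · 2 ^ n` this is the coordinate-only floor of `P₂` that grows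
  as `P₁ → 1` at fixed `B < 1` (many tiny leaves force `P₂ ≈ 2 ^ n B` large).
-/

namespace PercRepro

namespace TreeClosure

open Finset

/-- `(1 + ∏ b)² ≤ ∏ (1 + b i²)` for at least two nonnegative factors. -/
theorem sq_one_add_prod_le_prod_one_add_sq {m : ℕ} (b : Fin (m + 2) → ℝ) (hb : ∀ i, 0 ≤ b i) :
    (1 + ∏ i, b i) ^ 2 ≤ ∏ i, (1 + b i ^ 2) := by
  induction m with
  | zero =>
    rw [Fin.prod_univ_two, Fin.prod_univ_two]
    nlinarith [sq_nonneg (b 0 - b 1), hb 0, hb 1]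
  | succ m ih =>
    rw [Fin.prod_univ_succ b, Fin.prod_univ_succ (fun i => 1 + b i ^ 2)]
    have ih' := ih (fun i => b i.succ) (fun i => hb _)
    have hp : 0 ≤ ∏ i : Fin (m + 2), b i.succ := prod_nonneg (fun i _ => hb _)
    have h0 := hb 0
    set p := ∏ i : Fin (m + 2), b i.succ with hp_def
    set Q := ∏ i : Fin (m + 2), (1 + b i.succ ^ 2) with hQ_def
    have h1 : (1 + b 0 * p) ^ 2 ≤ (1 + b 0 ^ 2) * (1 + p) ^ 2 := by
      nlinarith [sq_nonneg (b 0 - p), mul_nonneg hp (add_nonneg zero_le_one (sq_nonneg (b 0)))]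
    have h2 : (1 + b 0 ^ 2) * (1 + p) ^ 2 ≤ (1 + b 0 ^ 2) * Q :=
      mul_le_mul_of_nonneg_left ih' (by positivity)
    exact h1.trans h2

/-- `(1 + A)² ≤ P₁` for every star with at least two leaves. -/
theorem sq_one_add_prod_le_prod_one_add_sq_leaf {m : ℕ} (a : Fin (m + 2) → ℝ) (ha : ∀ i, 0 ≤ a i ∧ a i ≤ 1) :
    (1 + ∏ i, a i) ^ 2 ≤ ∏ i, (1 + a i ^ 2) :=
  sq_one_add_prod_le_prod_one_add_sq a (fun i => (ha i).1)

/-- `(1 + B)² ≤ P₂` for every star with at least two leaves. -/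
theorem sq_one_add_prod_one_sub_le_prod {m : ℕ} (a : Fin (m + 2) → ℝ) (ha : ∀ i, 0 ≤ a i ∧ a i ≤ 1) :
    (1 + ∏ i, (1 - a i)) ^ 2 ≤ ∏ i, (1 + (1 - a i) ^ 2) :=
  sq_one_add_prod_le_prod_one_add_sq (fun i => 1 - a i) (fun i => by linarith [(ha i).2])

/-- Weierstrass: `1 - ∏ (1 - a i) ≤ Σ a i` for leaves in `[0, 1]`. -/
theorem one_sub_prod_one_sub_le_sum {n : ℕ} (a : Fin n → ℝ) (ha : ∀ i, 0 ≤ a i ∧ a i ≤ 1) :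
    1 - ∏ i, (1 - a i) ≤ ∑ i, a i := by
  induction n with
  | zero => simp
  | succ n ih =>
    rw [Fin.prod_univ_succ, Fin.sum_univ_succ]
    have ih' := ih (fun i => a i.succ) (fun i => ha _)
    have hp1 : ∏ i : Fin n, (1 - a i.succ) ≤ 1 :=
      prod_le_one (fun i _ => by linarith [(ha i.succ).2]) (fun i _ => by linarith [(ha i.succ).1])
    have h0 := ha 0
    nlinarith [mul_nonneg h0.1 (sub_nonneg.2 hp1)]

/-- `Σ b i ^ 2 ≤ ∏ (1 + b i ^ 2) - 1` (finite-type version). -/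
theorem sum_sq_le_prod_one_add_sq_sub_one_fin {n : ℕ} (b : Fin n → ℝ) :
    ∑ i, b i ^ 2 ≤ ∏ i, (1 + b i ^ 2) - 1 := by
  induction n with
  | zero => simp
  | succ n ih =>
    rw [Fin.prod_univ_succ, Fin.sum_univ_succ]
    have ih' := ih (fun i => b i.succ)
    have h1 : 1 ≤ ∏ i : Fin n, (1 + b i.succ ^ 2) :=
      one_le_prod (fun i _ => by nlinarith [sq_nonneg (b i.succ)])
    nlinarith [sq_nonneg (b 0), mul_nonneg (sub_nonneg.2 h1) (sq_nonneg (b 0))]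

/-- `B · 2 ^ n ≤ P₂`: leafwise `2 (1 - a) ≤ 1 + (1 - a) ^ 2`. -/
theorem prod_one_sub_mul_two_pow_le {n : ℕ} (a : Fin n → ℝ) (ha : ∀ i, 0 ≤ a i ∧ a i ≤ 1) :
    (∏ i, (1 - a i)) * 2 ^ n ≤ ∏ i, (1 + (1 - a i) ^ 2) := by
  have h : (∏ i, (1 - a i)) * 2 ^ n = ∏ i : Fin n, (2 * (1 - a i)) := by
    rw [prod_mul_distrib, prod_const, card_univ, Fintype.card_fin]; ring
  rw [h]
  apply prod_le_prod
  · intro i _; linarith [(ha i).2]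
  · intro i _; nlinarith [sq_nonneg (a i)]

/-- Cauchy–Schwarz for the leaves: `(Σ a i) ^ 2 ≤ n · Σ a i ^ 2`. -/
theorem sq_sum_le_card_mul_sum_sq_fin {n : ℕ} (a : Fin n → ℝ) :
    (∑ i, a i) ^ 2 ≤ (n : ℝ) * ∑ i, a i ^ 2 := by
  have := sq_sum_le_card_mul_sum_sq (s := (univ : Finset (Fin n))) (f := a)
  simpa [card_univ, Fintype.card_fin] using this

/-- `n ^ 2 ≤ 2 · 2 ^ n`. -/
theorem nat_sq_le_two_mul_two_pow (n : ℕ) : ((n : ℝ)) ^ 2 ≤ 2 * 2 ^ n := by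
  induction n with
  | zero => norm_num
  | succ k ih =>
    rcases Nat.lt_or_ge k 3 with hk | hk
    · interval_cases k <;> norm_num
    · have hk' : (3 : ℝ) ≤ k := by exact_mod_cast hk
      have hk0 : (0 : ℝ) ≤ k := by positivity
      push_cast
      rw [pow_succ (2 : ℝ) k]
      nlinarith [ih, hk', pow_pos (by norm_num : (0 : ℝ) < 2) k, mul_nonneg hk0 (sub_nonneg.2 hk')]

/-- `n ^ 3 ≤ 6 · 2 ^ n`. -/
theorem nat_cube_le_six_mul_two_pow (n : ℕ) : ((n : ℝ)) ^ 3 ≤ 6 * 2 ^ n := by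
  induction n with
  | zero => norm_num
  | succ k ih =>
    rcases Nat.lt_or_ge k 4 with hk | hk
    · interval_cases k <;> norm_num
    · have hk' : (4 : ℝ) ≤ k := by exact_mod_cast hk
      have hk0 : (0 : ℝ) ≤ k := by positivity
      push_cast
      rw [pow_succ (2 : ℝ) k]
      have e1 : 4 * (k : ℝ) ^ 2 ≤ (k : ℝ) ^ 3 := by nlinarith [mul_nonneg (mul_nonneg hk0 hk0) (sub_nonneg.2 hk')]
      have e2 : 4 * (k : ℝ) ≤ (k : ℝ) ^ 2 := by nlinarith [mul_nonneg hk0 (sub_nonneg.2 hk')]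
      nlinarith [ih, hk', pow_pos (by norm_num : (0 : ℝ) < 2) k, e1, e2]

/-- `n ^ 4 ≤ 24 · 2 ^ n`. -/
theorem nat_pow_four_le_twentyfour_mul_two_pow (n : ℕ) : ((n : ℝ)) ^ 4 ≤ 24 * 2 ^ n := by
  induction n with
  | zero => norm_num
  | succ k ih =>
    rcases Nat.lt_or_ge k 6 with hk | hk
    · interval_cases k <;> norm_num
    · have hk' : (6 : ℝ) ≤ k := by exact_mod_cast hk
      have hk0 : (0 : ℝ) ≤ k := by positivity
      push_cast
      rw [pow_succ (2 : ℝ) k]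
      have e1 : 6 * (k : ℝ) ^ 3 ≤ (k : ℝ) ^ 4 := by
        nlinarith [mul_nonneg (mul_nonneg (mul_nonneg hk0 hk0) hk0) (sub_nonneg.2 hk')]
      have e2 : 6 * (k : ℝ) ^ 2 ≤ (k : ℝ) ^ 3 := by nlinarith [mul_nonneg (mul_nonneg hk0 hk0) (sub_nonneg.2 hk')]
      have e3 : 6 * (k : ℝ) ≤ (k : ℝ) ^ 2 := by nlinarith [mul_nonneg hk0 (sub_nonneg.2 hk')]
      nlinarith [ih, hk', pow_pos (by norm_num : (0 : ℝ) < 2) k, e1, e2, e3]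

/-- The coordinate-only floor of `P₂` from the leaf count: if `n ^ k ≤ c · 2 ^ n` for the number of leaves
`n = m + 2`, then `B (1 - B) ^ (2 k) ≤ c (P₁ - 1) ^ k P₂`. -/
theorem tiny_floor_of {m : ℕ} (a : Fin (m + 2) → ℝ) (ha : ∀ i, 0 ≤ a i ∧ a i ≤ 1) {k : ℕ} {c : ℝ}
    (hk : ((m + 2 : ℕ) : ℝ) ^ k ≤ c * 2 ^ (m + 2)) :
    (∏ i, (1 - a i)) * (1 - ∏ i, (1 - a i)) ^ (2 * k) ≤ c * (∏ i, (1 + a i ^ 2) - 1) ^ k * ∏ i, (1 + (1 - a i) ^ 2) := by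
  have hB0 : 0 ≤ ∏ i, (1 - a i) := prod_nonneg (fun i _ => by linarith [(ha i).2])
  have hB1 : ∏ i, (1 - a i) ≤ 1 := prod_le_one (fun i _ => by linarith [(ha i).2]) (fun i _ => by linarith [(ha i).1])
  have hs := one_sub_prod_one_sub_le_sum a ha
  have ht := sum_sq_le_prod_one_add_sq_sub_one_fin a
  have hcs := sq_sum_le_card_mul_sum_sq_fin a
  have hpow := prod_one_sub_mul_two_pow_le a ha
  have hs0 : 0 ≤ ∑ i, a i := sum_nonneg (fun i _ => (ha i).1)
  have ht0 : 0 ≤ ∑ i, a i ^ 2 := sum_nonneg (fun i _ => sq_nonneg _)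
  set B := ∏ i, (1 - a i) with hB_def
  set s := ∑ i, a i with hs_def
  set t := ∑ i, a i ^ 2 with ht_def
  set P1 := ∏ i, (1 + a i ^ 2) with hP1_def
  set P2 := ∏ i, (1 + (1 - a i) ^ 2) with hP2_def
  have hc0 : 0 ≤ c := by
    have : (0 : ℝ) ≤ ((m + 2 : ℕ) : ℝ) ^ k := by positivity
    have h2 : (0 : ℝ) < 2 ^ (m + 2) := by positivity
    nlinarith
  have e1 : (1 - B) ^ 2 ≤ ((m + 2 : ℕ) : ℝ) * t := by
    have := pow_le_pow_left₀ (sub_nonneg.2 hB1) hs 2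
    linarith
  have e2 : (1 - B) ^ (2 * k) ≤ (((m + 2 : ℕ) : ℝ) * t) ^ k := by
    rw [pow_mul]
    exact pow_le_pow_left₀ (sq_nonneg _) e1 k
  have e3 : (((m + 2 : ℕ) : ℝ) * t) ^ k ≤ c * 2 ^ (m + 2) * (P1 - 1) ^ k := by
    rw [mul_pow]
    have htk : t ^ k ≤ (P1 - 1) ^ k := pow_le_pow_left₀ ht0 ht k
    calc ((m + 2 : ℕ) : ℝ) ^ k * t ^ k ≤ (c * 2 ^ (m + 2)) * t ^ k :=
          mul_le_mul_of_nonneg_right hk (by positivity)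
      _ ≤ (c * 2 ^ (m + 2)) * (P1 - 1) ^ k := mul_le_mul_of_nonneg_left htk (by positivity)
  have e4 : (1 - B) ^ (2 * k) ≤ c * 2 ^ (m + 2) * (P1 - 1) ^ k := e2.trans e3
  calc B * (1 - B) ^ (2 * k) ≤ B * (c * 2 ^ (m + 2) * (P1 - 1) ^ k) := mul_le_mul_of_nonneg_left e4 hB0
    _ = c * (P1 - 1) ^ k * (B * 2 ^ (m + 2)) := by ring
    _ ≤ c * (P1 - 1) ^ k * P2 := by
        apply mul_le_mul_of_nonneg_left hpow
        have : 0 ≤ (P1 - 1) ^ k := by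
          apply pow_nonneg
          have : 1 ≤ P1 := one_le_prod (fun i _ => by nlinarith [sq_nonneg (a i)])
          linarith
        positivity

/-- `B (1 - B) ^ 4 ≤ 2 (P₁ - 1) ^ 2 P₂`. -/
theorem tiny_floor_two {m : ℕ} (a : Fin (m + 2) → ℝ) (ha : ∀ i, 0 ≤ a i ∧ a i ≤ 1) :
    (∏ i, (1 - a i)) * (1 - ∏ i, (1 - a i)) ^ 4 ≤ 2 * (∏ i, (1 + a i ^ 2) - 1) ^ 2 * ∏ i, (1 + (1 - a i) ^ 2) :=
  tiny_floor_of a ha (k := 2) (nat_sq_le_two_mul_two_pow (m + 2))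

/-- `B (1 - B) ^ 6 ≤ 6 (P₁ - 1) ^ 3 P₂`. -/
theorem tiny_floor_three {m : ℕ} (a : Fin (m + 2) → ℝ) (ha : ∀ i, 0 ≤ a i ∧ a i ≤ 1) :
    (∏ i, (1 - a i)) * (1 - ∏ i, (1 - a i)) ^ 6 ≤ 6 * (∏ i, (1 + a i ^ 2) - 1) ^ 3 * ∏ i, (1 + (1 - a i) ^ 2) :=
  tiny_floor_of a ha (k := 3) (nat_cube_le_six_mul_two_pow (m + 2))

/-- `B (1 - B) ^ 8 ≤ 24 (P₁ - 1) ^ 4 P₂`. -/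
theorem tiny_floor_four {m : ℕ} (a : Fin (m + 2) → ℝ) (ha : ∀ i, 0 ≤ a i ∧ a i ≤ 1) :
    (∏ i, (1 - a i)) * (1 - ∏ i, (1 - a i)) ^ 8 ≤ 24 * (∏ i, (1 + a i ^ 2) - 1) ^ 4 * ∏ i, (1 + (1 - a i) ^ 2) :=
  tiny_floor_of a ha (k := 4) (nat_pow_four_le_twentyfour_mul_two_pow (m + 2))

end TreeClosure

end PercRepro
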